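import Mathlib
import Literature.AlgebraicGeometry.Resolution.WeightedResolutionDatum
import Literature.AlgebraicGeometry.Resolution.CobordantBlowupGlobal
import Literature.AlgebraicGeometry.Resolution.CobordantBlowupRegularCentre
import Literature.AlgebraicGeometry.Resolution.ProjectiveSpaceRegular
import Literature.AlgebraicGeometry.Resolution.AlterationsProofs
import Literature.AlgebraicGeometry.Resolution.AlterationsLemma32
import Literature.AlgebraicGeometry.Resolution.SmoothOfRegularPerfectField
import Summits.ResolutionOfSingularities.ResolutionOfSingularities.Theorems.WeightedInvariantWeightedThesisDatumCobordantBridge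

/-!
# `WeightedThesis` — the global cobordant blow-up `B₊ → Y → Spec k` is smooth, separated, quasi-compact

Support lemmas for crux `stmt-ResolutionOfSingularities-0569`
(`Summit.ResolutionOfSingularities.ResolutionOfSingularities.Theses.WeightedInvariant.WeightedThesis`),
line `datum-glued-split` (RESHAPE 2), stub `stub_datumToHypersurfaceNonminimal` (tower half): the
cobordant TOWER of a weighted resolution datum `D` blows `Y` up along the datum's weighted centre and
repeats on the new ambient, and the datum's axioms only ever apply to an ambient that is smooth,
separated and quasi-compact over the perfect ground field `k`.

Here the new ambient is the GLOBAL cobordant blow-up of the library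
(`Literature/AlgebraicGeometry/Resolution/CobordantBlowupGlobal.lean`): for a Rees filtration `R'`
on `Y` whose pieces are the pieces of the datum's centre (`R'.ideal = (D.centre f X).piece`),
`B = R'.cobordantBlowup = Spec_Y ⊕ₙ 𝒥ₙ tⁿ`, `B₊ = R'.plus ⊆ B` and `σ₊ = R'.πPlus : B₊ → Y`.

* `sectionsRing_eq_extReesAlgebra` — over every affine open `U`, the sections ring `⊕ₙ 𝒥ₙ(U) tⁿ` of
  `B` is the datum's `Γ(U)[t⁻¹, Rₙ(U) tⁿ]` (bridge file `…DatumCobordantBridge`), so that on a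
  weighted chart it is of finite type and regular (Włodarczyk 2022, §2.3.9);
* `locallyOfFiniteType_π`, `isRegular_cobordantBlowup` — under the guard of axiom `(iii)` (the
  centre is a regular weighted centre) `π : B → Y` is locally of finite type and `B` is regular:
  both are local on `B`, and `B` is covered by the charts `Spec ⊕ₙ 𝒥ₙ(U) tⁿ = π⁻¹ U` over the
  weighted charts `U`;
* `stub_smooth_globalCobordantPlus` — **`B₊ → Y → Spec k` is smooth (regular and locally of finite
  type over a perfect field, `smooth_of_isRegular_of_perfectField`), separated (open immersion, then
  affine, then separated) and quasi-compact (`B` is locally Noetherian, so the open immersion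
  `B₊ ⊆ B` is quasi-compact; `π` is affine)**.

No definition is declared; all proofs are glue on Mathlib and the tree.
-/

noncomputable section

open CategoryTheory CategoryTheory.Limits AlgebraicGeometry TopologicalSpace
open Literature.AlgebraicGeometry.Resolution
open Summit.ResolutionOfSingularities.ResolutionOfSingularities.Theorems.WeightedThesis

set_option linter.dupNamespace false

namespace Summit.ResolutionOfSingularities.ResolutionOfSingularities.Theorems.WeightedThesis.GlobalCobordantPlus

universe u

/-! ## The charts of the global cobordant blow-up over weighted charts -/

section Chart

variable {Y : Scheme.{u}} (R : ReesAlgebraData Y) (R' : ReesFiltration Y)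
  (hR' : R'.ideal = R.piece)

include hR' in
/-- Over an affine open `U`, the sections ring `Γ(B, π⁻¹U) = ⊕ₙ 𝒥ₙ(U) tⁿ` of the global full
cobordant blow-up of a Rees filtration with the pieces of `R` is the datum's extended Rees algebra
`Γ(U)[t⁻¹, Rₙ(U) tⁿ]` (`extReesAlgebra_eq_extendedRees`). [cite: Wlodarczyk2022, Def. 5.1.1] -/
theorem sectionsRing_eq_extReesAlgebra (U : Y.affineOpens) :
    R'.sectionsRing U = extReesAlgebra (R.chartIdeals U) := by
  rw [show R'.sectionsRing U = (R'.filtration U).extendedRees from rfl,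
    ← DatumCobordantBridge.extReesAlgebra_eq_extendedRees]
  congr 1
  funext n
  rw [R'.filtration_ideal, hR']
  rfl

variable {U : Y.affineOpens} {m : ℕ} {u : Fin m → Γ(Y, U)} {w : Fin m → ℕ}

include hR' in
/-- On a weighted chart `(U, u, w)` the sections ring `⊕ₙ 𝒥ₙ(U) tⁿ` is of finite type over `Γ(U)`
(it is `Γ(U)[t⁻¹, uᵢ t^{wᵢ}]`, a quotient of a polynomial ring in `m + 1` variables).
[cite: Wlodarczyk2022, §2.3.9] -/
theorem finiteType_sectionsRing (h : R.IsWeightedChart U u w) :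
    Algebra.FiniteType Γ(Y, U) (R'.sectionsRing U) := by
  rw [sectionsRing_eq_extReesAlgebra R R' hR' U]
  exact DatumCobordantBridge.finiteType_extReesAlgebra_of_isWeightedChart R h

include hR' in
/-- On a weighted chart the chart `Spec ⊕ₙ 𝒥ₙ(U) tⁿ → Spec Γ(U)` of `π : B → Y` is locally of
finite type. [folklore] -/
theorem locallyOfFiniteType_SpecMap_diagramMap (h : R.IsWeightedChart U u w) :
    LocallyOfFiniteType (Spec.map (R'.diagramMap.app (.op ⟨U.1, U.2⟩))) := by
  haveI := finiteType_sectionsRing R R' hR' h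
  change LocallyOfFiniteType
    (Spec.map (CommRingCat.ofHom (algebraMap Γ(Y, U) (R'.sectionsRing U))))
  exact (HasRingHomProperty.Spec_iff (P := @LocallyOfFiniteType)).mpr
    (RingHom.finiteType_algebraMap.mpr inferInstance)

/-- The carrier of `π⁻¹ U` is the range of the chart immersion `Spec ⊕ₙ 𝒥ₙ(U) tⁿ ⟶ B`. [folklore] -/
theorem range_ι_preimage_eq (U : Y.affineOpens) :
    Set.range (R'.π ⁻¹ᵁ (U : Y.Opens)).ι = Set.range (R'.openCover.f ⟨U.1, U.2⟩) := by
  simpa using congr($(R'.π_preimage ⟨U.1, U.2⟩).1)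

include hR' in
/-- On a weighted chart `U`, the chart `Spec ⊕ₙ 𝒥ₙ(U) tⁿ ⟶ B → Y` is locally of finite type (of
finite type over `Spec Γ(U) ≅ U`, followed by the open immersion `U ⊆ Y`). [folklore] -/
theorem locallyOfFiniteType_openCover_f_π (h : R.IsWeightedChart U u w) :
    LocallyOfFiniteType (R'.openCover.f ⟨U.1, U.2⟩ ≫ R'.π) := by
  have h₂ : LocallyOfFiniteType (⟨U.1, U.2⟩ : Y.AffineZariskiSite).2.fromSpec := inferInstance
  rw [R'.ι_π]
  exact MorphismProperty.comp_mem @LocallyOfFiniteType _ _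
    (locallyOfFiniteType_SpecMap_diagramMap R R' hR' h) h₂

include hR' in
/-- On a weighted chart `U`, `π⁻¹ U ⊆ B → Y` is locally of finite type (`π⁻¹ U ≅ Spec ⊕ₙ 𝒥ₙ(U) tⁿ`).
[folklore] -/
theorem locallyOfFiniteType_preimage_ι_π (h : R.IsWeightedChart U u w) :
    LocallyOfFiniteType ((R'.π ⁻¹ᵁ (U : Y.Opens)).ι ≫ R'.π) := by
  rw [← IsOpenImmersion.isoOfRangeEq_hom_fac (R'.π ⁻¹ᵁ (U : Y.Opens)).ι
    (R'.openCover.f ⟨U.1, U.2⟩) (range_ι_preimage_eq R' U), Category.assoc]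
  exact MorphismProperty.comp_mem @LocallyOfFiniteType _ _
    (locallyOfFiniteType_of_isOpenImmersion _) (locallyOfFiniteType_openCover_f_π R R' hR' h)

include hR' in
/-- **On a weighted chart of a regular locally Noetherian `Y`, the chart `Spec ⊕ₙ 𝒥ₙ(U) tⁿ` of the
global full cobordant blow-up is a regular scheme** (Włodarczyk 2022, §2.3.9, through the bridge
`isRegularRing_extReesAlgebra_of_isWeightedChart`). [cite: Wlodarczyk2022, §2.3.9] -/
theorem isRegular_Spec_sectionsRing [IsLocallyNoetherian Y] (hY : Scheme.IsRegular Y)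
    (h : R.IsWeightedChart U u w) :
    Scheme.IsRegular (Spec (CommRingCat.of (R'.sectionsRing U))) := by
  haveI : IsRegularRing (R'.sectionsRing U) := by
    rw [sectionsRing_eq_extReesAlgebra R R' hR' U]
    exact DatumCobordantBridge.isRegularRing_extReesAlgebra_of_isWeightedChart hY R h
  exact Scheme.isRegular_Spec _

end Chart

/-! ## `π : B → Y` is locally of finite type and `B` is regular -/

section Global

variable {Y : Scheme.{u}} (R : ReesAlgebraData Y) (R' : ReesFiltration Y)
  (hR' : R'.ideal = R.piece)

include hR' in
/-- **For a regular weighted centre, `π : B = Spec_Y ⊕ₙ 𝒥ₙ tⁿ → Y` is locally of finite type**: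
locally on `B`, over the weighted charts `U` (which cover `Y`), it is `π⁻¹ U ≅ Spec ⊕ₙ 𝒥ₙ(U) tⁿ → U`.
[cite: Wlodarczyk2022, Def. 2.3.5] -/
theorem locallyOfFiniteType_π (hc : R.IsRegularWeightedCentre) : LocallyOfFiniteType R'.π := by
  choose U hyU m u w hchart using hc
  refine IsZariskiLocalAtSource.of_iSup_eq_top (P := @LocallyOfFiniteType)
    (fun y => R'.π ⁻¹ᵁ (U y : Y.Opens)) ?_
    fun y => locallyOfFiniteType_preimage_ι_π R R' hR' (hchart y)
  exact top_le_iff.mp fun b _ => Opens.mem_iSup.mpr ⟨R'.π b, hyU (R'.π b)⟩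

include hR' in
/-- **For a regular weighted centre on a regular locally Noetherian `Y`, the global full cobordant
blow-up `B = Spec_Y ⊕ₙ 𝒥ₙ tⁿ` is a regular scheme**: it is covered by the open charts
`Spec ⊕ₙ 𝒥ₙ(U) tⁿ = π⁻¹ U` over the weighted charts `U`, each regular by Włodarczyk's §2.3.9.
[cite: Wlodarczyk2022, §2.3.9] -/
theorem isRegular_cobordantBlowup [IsLocallyNoetherian Y] (hY : Scheme.IsRegular Y)
    (hc : R.IsRegularWeightedCentre) : Scheme.IsRegular R'.cobordantBlowup := by
  refine Scheme.IsRegular.of_forall_exists_isOpenImmersion fun b => ?_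
  obtain ⟨U, hyU, m, u, w, hchart⟩ := hc (R'.π b)
  refine ⟨_, R'.openCover.f ⟨U.1, U.2⟩, inferInstance, ?_,
    isRegular_Spec_sectionsRing R R' hR' hY hchart⟩
  have hb : b ∈ Set.range (R'.π ⁻¹ᵁ (U : Y.Opens)).ι := by
    rw [Scheme.Opens.range_ι]
    exact hyU
  rwa [range_ι_preimage_eq R' U] at hb

/-- The open `B₊ ⊆ B` of a regular `B` is regular. [folklore] -/
theorem isRegular_plus (hB : Scheme.IsRegular R'.cobordantBlowup) :
    Scheme.IsRegular (R'.plus : Scheme.{u}) :=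
  Scheme.IsRegular.of_isOpenImmersion R'.plus.ι hB

end Global

/-! ## The stub: `B₊ → Y → Spec k` is smooth, separated and quasi-compact -/

/-- **Over a perfect field, the global cobordant blow-up of the datum's centre is again a smooth
separated quasi-compact ambient.** For a weighted resolution datum `D`, `f : Y → Spec k` smooth,
separated and quasi-compact over a perfect field `k` of characteristic `p`, an ideal sheaf `X` with
`inv` not everywhere minimal (so that, by axiom `(iii)`, the centre `D.centre f X` is a regular
weighted centre), and any Rees filtration `R'` on `Y` with the pieces of the centre, the structure
map `σ₊ ≫ f : B₊ → Y → Spec k` of the global cobordant blow-up `B₊ = Spec_Y(⊕ₙ 𝒥ₙ tⁿ) ∖ Vert` is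
smooth (`B` is regular by Włodarczyk's §2.3.9 on every weighted chart and `π` is locally of finite
type, hence `B₊` is smooth over the perfect field), separated (`B₊ ⊆ B` open, `π` affine, `f`
separated) and quasi-compact (`B` is locally Noetherian, so `B₊ ⊆ B` is quasi-compact) — the standing
hypotheses under which the datum's axioms apply to `(B₊, strict transform)`, the next step of the
cobordant tower. [cite: Wlodarczyk2022, §2.3.9 and Def. 5.1.1] -/
theorem stub_smooth_globalCobordantPlus : ∀ {p : ℕ} (D : Literature.AlgebraicGeometry.Resolution.WeightedResolutionDatum p) {k : Type} [Field k] [CharP k p] [PerfectField k] {Y : AlgebraicGeometry.Scheme.{0}} (f : Y ⟶ AlgebraicGeometry.Spec (.of k)) [AlgebraicGeometry.Smooth f] [AlgebraicGeometry.IsSeparated f] [AlgebraicGeometry.QuasiCompact f] (X : Y.IdealSheafData), (∃ y : Y, ¬ IsBot (D.inv f X y)) → ∀ (R' : Literature.AlgebraicGeometry.Resolution.ReesFiltration Y), R'.ideal = (D.centre f X).piece → AlgebraicGeometry.Smooth (R'.πPlus ≫ f) ∧ AlgebraicGeometry.IsSeparated (R'.πPlus ≫ f) ∧ AlgebraicGeometry.QuasiCompact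 (R'.πPlus ≫ f) := by
  intro p D k _ _ _ Y f _ _ _ X hguard R' hR'
  haveI : IsLocallyNoetherian Y := LocallyOfFiniteType.isLocallyNoetherian f
  have hY : Scheme.IsRegular Y := Scheme.IsRegular.of_smooth f (Scheme.isRegular_Spec (.of k))
  have hc : (D.centre f X).IsRegularWeightedCentre := D.isRegularWeightedCentre_centre f X hguard
  haveI : LocallyOfFiniteType R'.π := locallyOfFiniteType_π (D.centre f X) R' hR' hc
  haveI : IsLocallyNoetherian R'.cobordantBlowup := LocallyOfFiniteType.isLocallyNoetherian R'.π
  have hBplus : Scheme.IsRegular (R'.plus : Scheme.{0}) :=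
    isRegular_plus R' (isRegular_cobordantBlowup (D.centre f X) R' hR' hY hc)
  haveI : LocallyOfFiniteType (R'.πPlus ≫ f) := by
    show LocallyOfFiniteType ((R'.plus.ι ≫ R'.π) ≫ f)
    infer_instance
  haveI : IsSeparated (R'.πPlus ≫ f) := by
    show IsSeparated ((R'.plus.ι ≫ R'.π) ≫ f)
    infer_instance
  haveI : QuasiCompact (R'.πPlus ≫ f) := by
    show QuasiCompact ((R'.plus.ι ≫ R'.π) ≫ f)
    infer_instance
  exact ⟨smooth_of_isRegular_of_perfectField _ hBplus, inferInstance, inferInstance⟩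

end Summit.ResolutionOfSingularities.ResolutionOfSingularities.Theorems.WeightedThesis.GlobalCobordantPlus

end
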